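import Summits.QuantumFields.YangMills.Theorems.BalabanUVNodesN15KingModelProp37AtRegularFieldHolder
import Literature.Analysis.Calculus.ExpDuhamel

/-!
# N15 (NE2⁺, row s3 KING-MODEL ∕ RIEMANN-KERNEL RUNG) — PART Ζ-h₁: THE ENTRYWISE (GAUGE-VARIANT) TRANSPORT-FREE HÖLDER LINES (3.65) OF KING 1986
# PROPOSITION 3.7 AT A REGULAR BACKGROUND, IN KING's GAUGE — the matrix ENTRIES `G_(j)(x,z)_{ii′}`, under the sup-norm smallness `d·|e|·‖A‖_∞·L^kε ≤ 1`

count-neutral helper of the pub-ymgap K3⁸ programme (`--supports stmt-QuantumFields-27366`); nothing here is a claim about Bałaban's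
non-abelian `G(U)`, the continuum, ℝ⁴, OS axioms, a mass gap or the Clay problem.  One finite torus `T_ε` at fixed `ε`.

## Why this file (closing PART Ζ-a's scope line, referee ref-F READ-756 SL-2)

PART Ζ-a∕b read King's `|G^η_{(j)}(x, y)|` and the Hölder quotient (3.62) on the gauge-INVARIANT block norm, for which the transport of [Ba3] (2.11) is
immaterial; the Hölder faces so certified bound `||G(x,z)| − |G(y,z)||`, which is WEAKER than King's `|G(x,z) − G(y,z)|` read on the matrix entries.  King's
entrywise transport-free differences are gauge-VARIANT: they are meaningful in the gauge of p. 661, where after the gauge transformation (3.43)–(3.46)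
the field is small in sup norm, *"|Ã^{(k)}(x)| ≤ Cp(L^kε)|x − x₀|. (3.45)"* (text layer p0013).  THIS FILE proves the ENTRYWISE lines under the one explicit
sup-norm hypothesis that regime supplies — `|A_b| ≤ A_∞` on all bonds with `d·|e|·A_∞·(L^kε) ≤ 1` — by the same step∕chain∕near∕far route as PART Ζ-a, the
link variables now costing the defect `‖U(A_b) − 1‖ ≤ e^{ε|e||A_b|} − 1 ≤ 2ε|e||A_b|` (the tree's [folklore] `Literature.Analysis.Calculus.norm_exp_sub_one_le`,
Mathlib `Real.abs_exp_sub_one_le`).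

## What is printed

[King1986] Prop. 3.7 (3.62)–(3.65) p. 663 (quoted in PART Ζ-a); p. 665 l. 27–29 «Proposition 3.7 also holds for G_(j)(□′) and G_(j)(□′, Ã^{(k)})»; p. 661
(3.43)–(3.46) (the re-gauging; displays on the un-held render p013 — only the text layer is read here).  [Balaban1983Higgs3] (2.10)–(2.11) p. 426
(lit-balaban p26, consumed as the hypotheses `Ineq210`, `Ineq211At` of PART Ζ-a).

## What this file proves (0 `sorry`; 2 `def`s = the entry kernels; p26's displays enter as hypotheses)

* §1 `norm_U_apply_sub_self_le` (`‖U(A_b)v − v‖ ≤ (e^{|ε e A_b|} − 1)‖v‖`), `norm_U_apply_sub_self_le_two` (`≤ 2|εeA_b|·‖v‖` when `|εeA_b| ≤ 1`),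
  `norm_hol_apply_sub_self_le` (along a chain of `n` bonds: `≤ n·2ε|e|A_∞·‖v‖`).
* §2 defs `entG j i i′ x z = ε^{−d}·⟪b_i, (G^η_{(j)}e_{(z,i′)})(x)⟫`, `entDG j μ i i′ x z` (the `(i,i′)` ENTRY of the block and of its covariant derivative in the
  row variable); `abs_entG_le` ∕ `abs_entDG_le` (an entry is below p26's column-sum norm `absG` ∕ `absDG`).
* §3 ★ `entG_step_le` — the plain one-bond step of an ENTRY: `|G(x+εe_μ,z)_{ii′} − G(x,z)_{ii′}| ≤ ε|D_AG(x,z)| + 2ε|e||A_{⟨x,μ⟩}|·|G(x+εe_μ,z)|`;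
  `entG_chain_le` ∕ `entG_chain_le'` (telescoping along a chain); §4 ★ `entG_holder_far` (far pairs `L^jε ≤ ε|x−y|`: sizes, constant `2C`).
This file ENDS at §4 `entG_holder_far` (11 declarations).  The two all-pairs Hölder lines announced for this part live in the SEQUELS (the part was
split at the 400-line limit; v1.1 docstring correction, dag-ref-K READ-449 D1 flag): the sequel Ζ-h₂ `…Prop37AtRegularFieldEntryLines` (p692816) proves
★ `entG_holder_near`, ★★ **`entG_holder_le`** — (3.65)₁ ENTRYWISE, ALL pairs `x ≠ y`, slices `j + 1 ≤ k`, under `Ineq210 δ C`, `|A_b| ≤ A_∞`,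
`d|e|A_∞L^kε ≤ 1`, constant `(3d·e^{δ(d+1)} + 2)·C` — and `abs_entDG_sub_le`, ★★ **`entDG_holder_le`** — (3.65)₂ ENTRYWISE under `Ineq210` + `Ineq211At α δ C`
+ the same gauge hypothesis (the transported term is p26's, the transport defect along the staircase costs `2d·ε|x−y|·|e|A_∞`; constant `3·C`); the
sequel Ζ-h₃ `…Prop37AtRegularFieldEntrywise` (p694566) builds the entrywise datum `kingSliceKernelsRegEnt` and inhabits `Prop37PrintedAt` in King's gauge
(`prop37PrintedAt_king_regularField_entry`, and `prop37KingOrder_king_zeroField_entry` hypothesis-free at `A = 0`).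

HONEST SCOPE.  The sup-norm hypothesis is NOT implied by regularity (2.23) (a regular field may have large constant parts ∕ holonomy); it is King's
re-gauged regime (3.45), carried explicitly; without it only the block-norm reading (PARTS Ζ-a…Ζ-f) is available.  `Ω = T_ε`; constants those of the hypotheses.
Unit `pub-ymgap-dag-n15-e` g22 (R141 (C) s3), PART Ζ-h₁; v1.1 (g23): DOCSTRING-ONLY edition of this module header (every declaration byte-identical).
-/

noncomputable section

open scoped BigOperators

namespace Summit.QuantumFields.YangMills.BalabanUVNodes.N15KingModelRung.RegularField

open Literature.MathematicalPhysics.QuantumFieldTheory.Balaban1983to89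
open Literature.MathematicalPhysics.QuantumFieldTheory.Balaban1983to89.HiggsLattice (ChargeData ScalarField covDeriv)
open Literature.MathematicalPhysics.QuantumFieldTheory.Balaban1983to89.HiggsCovariance (E)
open Literature.MathematicalPhysics.QuantumFieldTheory.Balaban1983to89.B1Eq221Coordinates (fieldCoord)
open Literature.MathematicalPhysics.QuantumFieldTheory.Balaban1983to89.B1Eq230FluctCov (Ix cb)
open Literature.MathematicalPhysics.QuantumFieldTheory.Balaban1983to89.B1Ineq227BackgroundTorus (abs_fieldCoord_le)
open Literature.MathematicalPhysics.QuantumFieldTheory.Balaban1983to89.B1Ineq234LevelZero (tdist_comm tdist_triangle_real tdist_shift_le_one)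
open Literature.MathematicalPhysics.QuantumFieldTheory.Balaban1983to89.B1TorusChainTransport (IsTChain TNbr hol hol_nil hol_cons_apply bondVal
  bondVal_shift bondVal_of_shift norm_hol_apply tdist_mem_chain_le U_apply_sub_eq_smul_covDeriv)
open Literature.MathematicalPhysics.QuantumFieldTheory.Balaban1983to89.B2Restr216Lattice (norm_U_apply)
open Literature.MathematicalPhysics.QuantumFieldTheory.Balaban1983to89.B4GaugeCovariance (pathEnd)
open Literature.MathematicalPhysics.QuantumFieldTheory.Balaban1983to89.B3Sect2StatementsPart2 (ScaledKernels)
open Literature.MathematicalPhysics.QuantumFieldTheory.Balaban1983to89.B1Eq211ZeroFieldTorus (Shape)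
open Literature.MathematicalPhysics.QuantumFieldTheory.Balaban1983to89.B3Ineq210RegularTorus (pieceA regTorusKernels regTorusKernels_absG
  regTorusKernels_absDG regTorusKernels_dist scale_eq mesh_eq_pow_mul)
open Literature.MathematicalPhysics.QuantumFieldTheory.Balaban1983to89.B3Ineq211RegularTorus (IsAdm exists_isAdm one_le_tdist_of_ne' holderTerm
  holderTerm_le_holderDiff regTorusKernelsH scaleH_eq)

variable {P : HiggsLattice.Params} {N : ℕ}

/-! ## §1 The transport defect `U(A_b) − 1` in King's gauge -/

/-- **`‖U(A_b)v − v‖ ≤ (e^{|ηeA_b|} − 1)·‖v‖`** (`U = exp((ηeA_b)q)`, `‖q‖ ≤ 1`; the tree's [folklore] `norm_exp_sub_one_le`). [cite: Balaban1982Higgs1, (1.7) p.605] [cite: King1986, (3.45)–(3.46) p.661] -/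
theorem norm_U_apply_sub_self_le (C : ChargeData N) (η a : ℝ) (v : EuclideanSpace ℝ (Fin N)) :
    ‖C.U η a v - v‖ ≤ (Real.exp (|η * C.e * a|) - 1) * ‖v‖ := by
  have h1 : C.U η a v - v = (C.U η a - 1) v := by simp
  rw [h1]
  refine (ContinuousLinearMap.le_opNorm _ _).trans (mul_le_mul_of_nonneg_right ?_ (norm_nonneg _))
  unfold ChargeData.U
  refine (_root_.Literature.Analysis.Calculus.norm_exp_sub_one_le _).trans ?_
  have hX : ‖(η * C.e * a) • C.q‖ ≤ |η * C.e * a| := by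
    rw [norm_smul, Real.norm_eq_abs]
    exact mul_le_of_le_one_right (abs_nonneg _) C.norm_q_le
  linarith [Real.exp_le_exp.2 hX]

/-- **linearised**: `‖U(A_b)v − v‖ ≤ 2|ηeA_b|·‖v‖` when `|ηeA_b| ≤ 1` (Mathlib `Real.abs_exp_sub_one_le`). [cite: King1986, (3.45)–(3.46) p.661] -/
theorem norm_U_apply_sub_self_le_two (C : ChargeData N) {η a : ℝ} (h : |η * C.e * a| ≤ 1) (v : EuclideanSpace ℝ (Fin N)) :
    ‖C.U η a v - v‖ ≤ 2 * |η * C.e * a| * ‖v‖ := by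
  refine (norm_U_apply_sub_self_le C η a v).trans (mul_le_mul_of_nonneg_right ?_ (norm_nonneg _))
  have h2 := Real.abs_exp_sub_one_le (x := |η * C.e * a|) (by rwa [abs_abs])
  rw [abs_abs] at h2
  exact (le_abs_self _).trans h2

/-- **the defect of the transport along a chain**: if every bond variable met along the nearest-neighbour chain `x, l` has `|A_b| ≤ A_∞` (here: all bonds) and
`ε|e|A_∞ ≤ 1`, then `‖U(A(Γ))v − v‖ ≤ |Γ|·2ε|e|A_∞·‖v‖` (the torus has more than two sites per direction, so the pair form on a bond is `±A_b`).
[cite: King1986, (3.45)–(3.46) p.661] [cite: Balaban1983RegularityDecay, (1.4) p.572] -/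
theorem norm_hol_apply_sub_self_le {k : ℕ} (hS : ∀ μ, 2 < P.sitesPerDir k μ) (C : ChargeData N) (A : HiggsLattice.VecField P k) {Asup : ℝ}
    (hA : ∀ b, |A b| ≤ Asup) (hsmall : P.mesh k * |C.e| * Asup ≤ 1) (v : EuclideanSpace ℝ (Fin N)) :
    ∀ (x : HiggsLattice.Site P k) (l : List (HiggsLattice.Site P k)), IsTChain x l →
      ‖hol C A x l v - v‖ ≤ l.length * (2 * (P.mesh k * |C.e| * Asup)) * ‖v‖ := by
  intro x l
  induction l generalizing x with
  | nil => intro _; simp [hol_nil]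
  | cons y l ih =>
      intro hch
      obtain ⟨⟨μ, hμ⟩, hl⟩ := hch
      have hε : 0 ≤ P.mesh k := (P.mesh_pos k).le
      have hAsup0 : 0 ≤ Asup := (abs_nonneg _).trans (hA ⟨x, μ⟩)
      -- the bond variable of the first step
      have hb : |bondVal A x y| ≤ Asup := by
        rcases hμ with rfl | rfl
        · rw [bondVal_shift hS]; exact hA _
        · rw [bondVal_of_shift hS, abs_neg]; exact hA _
      have hbb : |P.mesh k * C.e * bondVal A x y| ≤ P.mesh k * |C.e| * Asup := by
        rw [abs_mul, abs_mul, abs_of_nonneg hε]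
        exact mul_le_mul_of_nonneg_left hb (mul_nonneg hε (abs_nonneg _))
      have hstep : ‖C.U (P.mesh k) (bondVal A x y) v - v‖ ≤ 2 * (P.mesh k * |C.e| * Asup) * ‖v‖ :=
        (norm_U_apply_sub_self_le_two C (hbb.trans hsmall) v).trans
          (mul_le_mul_of_nonneg_right (mul_le_mul_of_nonneg_left hbb (by norm_num)) (norm_nonneg _))
      rw [hol_cons_apply]
      have hsplit : C.U (P.mesh k) (bondVal A x y) (hol C A y l v) - v
          = C.U (P.mesh k) (bondVal A x y) (hol C A y l v - v) + (C.U (P.mesh k) (bondVal A x y) v - v) := by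
        rw [map_sub]; abel
      rw [hsplit]
      refine (norm_add_le _ _).trans ?_
      rw [norm_U_apply]
      simp only [List.length_cons, Nat.cast_succ]
      calc ‖hol C A y l v - v‖ + ‖C.U (P.mesh k) (bondVal A x y) v - v‖
          ≤ l.length * (2 * (P.mesh k * |C.e| * Asup)) * ‖v‖ + 2 * (P.mesh k * |C.e| * Asup) * ‖v‖ := add_le_add (ih y hl) hstep
        _ = (l.length + 1) * (2 * (P.mesh k * |C.e| * Asup)) * ‖v‖ := by ring

/-! ## §2 The matrix entries of the slice kernels and of their covariant derivatives -/

section Torus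

variable {S : Shape P} {C : ChargeData N} {A : HiggsLattice.VecField P 0} {msq a : ℝ} {k : ℕ}

/-- the `(i,i′)` ENTRY of the block `G^η_{(j)}(x, z)` (kernel w.r.t. the `ε^d`-sum, King's transport-free reading): `ε^{−d}·⟪b_i, (G^η_{(j)}e_{(z,i′)})(x)⟫`.
[cite: King1986, Prop 3.7 (3.63) p.663] [cite: Balaban1983Higgs3, (2.10) p.426] -/
def entG (C : ChargeData N) (A : HiggsLattice.VecField P 0) (msq a : ℝ) (k j : ℕ) (i i' : Ix N) (x z : HiggsLattice.Site P 0) : ℝ :=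
  (P.mesh 0 ^ P.d)⁻¹ * fieldCoord (E N) (HiggsLattice.Site P 0) (pieceA C A msq a k j (cb P N 0 (z, i'))) (x, i)

/-- the `(i,i′)` ENTRY of the covariant derivative `(D_{A,μ}G^η_{(j)})(x, z)` in the row variable. [cite: King1986, Prop 3.7 (3.63) p.663] [cite: Balaban1983Higgs3, (2.10) p.426] -/
def entDG (C : ChargeData N) (A : HiggsLattice.VecField P 0) (msq a : ℝ) (k j : ℕ) (μ : Fin P.d) (i i' : Ix N) (x z : HiggsLattice.Site P 0) : ℝ :=
  (P.mesh 0 ^ P.d)⁻¹ * fieldCoord (E N) (HiggsLattice.Site P 0)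
    (fun w => covDeriv C A (pieceA C A msq a k j (cb P N 0 (z, i'))) ⟨w, μ⟩) (x, i)

/-- an entry is below the column-sum norm: `|G(x,z)_{ii′}| ≤ |G(x,z)|` (p26's `absG`). [cite: Balaban1983Higgs3, (2.10) p.426] -/
theorem abs_entG_le (j : ℕ) (i i' : Ix N) (x z : HiggsLattice.Site P 0) :
    |entG C A msq a k j i i' x z| ≤ (regTorusKernels S C A msq a k).absG j x z := by
  rw [entG, regTorusKernels_absG, abs_mul, abs_of_nonneg (inv_nonneg.2 (pow_nonneg (P.mesh_pos 0).le _))]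
  refine mul_le_mul_of_nonneg_left ((abs_fieldCoord_le _ x i).trans ?_) (inv_nonneg.2 (pow_nonneg (P.mesh_pos 0).le _))
  exact Finset.single_le_sum (f := fun i' : Ix N => ‖pieceA C A msq a k j (cb P N 0 (z, i')) x‖) (fun _ _ => norm_nonneg _) (Finset.mem_univ i')

/-- the derivative entry is below `absDG`. [cite: Balaban1983Higgs3, (2.10) p.426] -/
theorem abs_entDG_le (j : ℕ) (μ : Fin P.d) (i i' : Ix N) (x z : HiggsLattice.Site P 0) :
    |entDG C A msq a k j μ i i' x z| ≤ (regTorusKernels S C A msq a k).absDG j μ x z := by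
  rw [entDG, regTorusKernels_absDG, abs_mul, abs_of_nonneg (inv_nonneg.2 (pow_nonneg (P.mesh_pos 0).le _))]
  refine mul_le_mul_of_nonneg_left ((abs_fieldCoord_le _ x i).trans ?_) (inv_nonneg.2 (pow_nonneg (P.mesh_pos 0).le _))
  exact Finset.single_le_sum (f := fun i' : Ix N => ‖covDeriv C A (pieceA C A msq a k j (cb P N 0 (z, i'))) ⟨x, μ⟩‖)
    (fun _ _ => norm_nonneg _) (Finset.mem_univ i')

/-! ## §3 The one-bond step of an entry in King's gauge, and chain telescoping -/

/-- ★ **THE ENTRYWISE ONE-BOND STEP**: `|G(x+εe_μ,z)_{ii′} − G(x,z)_{ii′}| ≤ ε·|(D_{A,μ}G)(x,z)| + 2ε|e||A_{⟨x,μ⟩}|·|G(x+εe_μ,z)|` when `ε|e||A_{⟨x,μ⟩}| ≤ 1`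
(`φ(b₊) − φ(b₋) = ε(D_Aφ)(b) − (U(A_b) − 1)φ(b₊)`). [cite: King1986, (3.62) p.663, (3.45)–(3.46) p.661] [cite: Balaban1982Higgs1, (1.7) p.605] -/
theorem entG_step_le (j : ℕ) (i i' : Ix N) (x z : HiggsLattice.Site P 0) (μ : Fin P.d) (hb : |P.mesh 0 * C.e * A ⟨x, μ⟩| ≤ 1) :
    |entG C A msq a k j i i' (x.shift μ) z - entG C A msq a k j i i' x z|
      ≤ P.mesh 0 * (regTorusKernels S C A msq a k).absDG j μ x z
        + 2 * |P.mesh 0 * C.e * A ⟨x, μ⟩| * (regTorusKernels S C A msq a k).absG j (x.shift μ) z := by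
  set φ := pieceA C A msq a k j (cb P N 0 (z, i')) with hφ
  have hε : 0 < P.mesh 0 := P.mesh_pos 0
  have hεd : 0 ≤ (P.mesh 0 ^ P.d)⁻¹ := inv_nonneg.2 (pow_nonneg hε.le _)
  -- the entry difference is a coordinate of `φ(x+e_μ) − φ(x)`
  have hdiff : entG C A msq a k j i i' (x.shift μ) z - entG C A msq a k j i i' x z
      = (P.mesh 0 ^ P.d)⁻¹ * fieldCoord (E N) (HiggsLattice.Site P 0) (fun w => φ (w.shift μ) - φ w) (x, i) := by
    rw [entG, entG, ← mul_sub]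
    congr 1
    rw [show (fun w => φ (w.shift μ) - φ w) = (fun w => φ (w.shift μ)) - φ from rfl, map_sub]
    rfl
  rw [hdiff, abs_mul, abs_of_nonneg hεd]
  have hcoord := abs_fieldCoord_le (fun w => φ (w.shift μ) - φ w) x i
  -- `φ(x⁺) − φ(x) = ε D φ(b) − (Uφ(x⁺) − φ(x⁺))`
  have hid : φ (x.shift μ) - φ x
      = P.mesh 0 • covDeriv C A φ ⟨x, μ⟩ - (C.U (P.mesh 0) (A ⟨x, μ⟩) (φ (x.shift μ)) - φ (x.shift μ)) := by
    rw [← U_apply_sub_eq_smul_covDeriv]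
    show φ (x.shift μ) - φ x = C.U (P.mesh 0) (A ⟨x, μ⟩) (φ (x.shift μ)) - φ x - (C.U (P.mesh 0) (A ⟨x, μ⟩) (φ (x.shift μ)) - φ (x.shift μ))
    abel
  have hnorm : ‖φ (x.shift μ) - φ x‖ ≤ P.mesh 0 * ‖covDeriv C A φ ⟨x, μ⟩‖ + 2 * |P.mesh 0 * C.e * A ⟨x, μ⟩| * ‖φ (x.shift μ)‖ := by
    rw [hid]
    refine (norm_sub_le _ _).trans (add_le_add ?_ (norm_U_apply_sub_self_le_two C hb _))
    rw [norm_smul, Real.norm_of_nonneg hε.le]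
  -- compare with the column sums
  have h1 : ‖covDeriv C A φ ⟨x, μ⟩‖ ≤ ∑ i'' : Ix N, ‖covDeriv C A (pieceA C A msq a k j (cb P N 0 (z, i''))) ⟨x, μ⟩‖ :=
    Finset.single_le_sum (f := fun i'' : Ix N => ‖covDeriv C A (pieceA C A msq a k j (cb P N 0 (z, i''))) ⟨x, μ⟩‖)
      (fun _ _ => norm_nonneg _) (Finset.mem_univ i')
  have h2 : ‖φ (x.shift μ)‖ ≤ ∑ i'' : Ix N, ‖pieceA C A msq a k j (cb P N 0 (z, i'')) (x.shift μ)‖ :=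
    Finset.single_le_sum (f := fun i'' : Ix N => ‖pieceA C A msq a k j (cb P N 0 (z, i'')) (x.shift μ)‖)
      (fun _ _ => norm_nonneg _) (Finset.mem_univ i')
  rw [regTorusKernels_absDG, regTorusKernels_absG]
  have hb0 : 0 ≤ 2 * |P.mesh 0 * C.e * A ⟨x, μ⟩| := by positivity
  calc (P.mesh 0 ^ P.d)⁻¹ * |fieldCoord (E N) (HiggsLattice.Site P 0) (fun w => φ (w.shift μ) - φ w) (x, i)|
      ≤ (P.mesh 0 ^ P.d)⁻¹ * (P.mesh 0 * ‖covDeriv C A φ ⟨x, μ⟩‖ + 2 * |P.mesh 0 * C.e * A ⟨x, μ⟩| * ‖φ (x.shift μ)‖) :=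
        mul_le_mul_of_nonneg_left (hcoord.trans hnorm) hεd
    _ ≤ (P.mesh 0 ^ P.d)⁻¹ * (P.mesh 0 * ∑ i'' : Ix N, ‖covDeriv C A (pieceA C A msq a k j (cb P N 0 (z, i''))) ⟨x, μ⟩‖
          + 2 * |P.mesh 0 * C.e * A ⟨x, μ⟩| * ∑ i'' : Ix N, ‖pieceA C A msq a k j (cb P N 0 (z, i'')) (x.shift μ)‖) :=
        mul_le_mul_of_nonneg_left (add_le_add (mul_le_mul_of_nonneg_left h1 hε.le) (mul_le_mul_of_nonneg_left h2 hb0)) hεd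
    _ = _ := by ring

/-- **entrywise chain telescoping in King's gauge**: along a nearest-neighbour chain `y, l` with `|A_b| ≤ A_∞` everywhere, `ε|e|A_∞ ≤ 1`, and
`ε|(D_{A,μ}G)(w,z)| + 2ε|e|A_∞|G(w+εe_μ,z)| ≤ M` at every chain site `w` and direction `μ`: `|G(end,z)_{ii′} − G(y,z)_{ii′}| ≤ n·M`. [cite: King1986, (3.62) p.663, (3.45) p.661] -/
theorem entG_chain_le (j : ℕ) (i i' : Ix N) (z : HiggsLattice.Site P 0) {Asup M : ℝ} (hA : ∀ b, |A b| ≤ Asup)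
    (hsmall : P.mesh 0 * |C.e| * Asup ≤ 1) :
    ∀ (y : HiggsLattice.Site P 0) (l : List (HiggsLattice.Site P 0)), IsTChain y l →
      (∀ w ∈ y :: l, ∀ μ : Fin P.d, P.mesh 0 * (regTorusKernels S C A msq a k).absDG j μ w z
          + 2 * (P.mesh 0 * |C.e| * Asup) * (regTorusKernels S C A msq a k).absG j (w.shift μ) z ≤ M) →
      |entG C A msq a k j i i' (pathEnd y l) z - entG C A msq a k j i i' y z| ≤ l.length * M := by
  have hε : 0 ≤ P.mesh 0 := (P.mesh_pos 0).le
  have hbnd : ∀ (x : HiggsLattice.Site P 0) (μ : Fin P.d), |P.mesh 0 * C.e * A ⟨x, μ⟩| ≤ P.mesh 0 * |C.e| * Asup := fun x μ => by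
    rw [abs_mul, abs_mul, abs_of_nonneg hε]
    exact mul_le_mul_of_nonneg_left (hA _) (mul_nonneg hε (abs_nonneg _))
  have hstep' : ∀ (x : HiggsLattice.Site P 0) (μ : Fin P.d),
      |entG C A msq a k j i i' (x.shift μ) z - entG C A msq a k j i i' x z|
        ≤ P.mesh 0 * (regTorusKernels S C A msq a k).absDG j μ x z
          + 2 * (P.mesh 0 * |C.e| * Asup) * (regTorusKernels S C A msq a k).absG j (x.shift μ) z := fun x μ =>
    (entG_step_le j i i' x z μ ((hbnd x μ).trans hsmall)).trans
      (add_le_add le_rfl (mul_le_mul_of_nonneg_right (mul_le_mul_of_nonneg_left (hbnd x μ) (by norm_num)) (absG_nonneg j _ z)))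
  intro y l
  induction l generalizing y with
  | nil => intro _ _; simp [pathEnd]
  | cons w l ih =>
      intro hch hM
      obtain ⟨⟨μ, hμ⟩, hl⟩ := hch
      have hrest := ih w hl (fun w' hw' μ' => hM w' (List.mem_cons_of_mem _ hw') μ')
      have hstep : |entG C A msq a k j i i' w z - entG C A msq a k j i i' y z| ≤ M := by
        rcases hμ with rfl | rfl
        · exact (hstep' y μ).trans (hM y List.mem_cons_self μ)
        · rw [abs_sub_comm]
          exact (hstep' w μ).trans (hM w (List.mem_cons_of_mem _ List.mem_cons_self) μ)
      simp only [pathEnd, List.length_cons, Nat.cast_succ]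
      calc |entG C A msq a k j i i' (pathEnd w l) z - entG C A msq a k j i i' y z|
          ≤ |entG C A msq a k j i i' (pathEnd w l) z - entG C A msq a k j i i' w z|
              + |entG C A msq a k j i i' w z - entG C A msq a k j i i' y z| := abs_sub_le _ _ _
        _ ≤ l.length * M + M := add_le_add hrest hstep
        _ = (l.length + 1) * M := by ring

/-- `entG_chain_le` with the end point named. [cite: King1986, (3.62) p.663] -/
theorem entG_chain_le' (j : ℕ) (i i' : Ix N) (z : HiggsLattice.Site P 0) {Asup M : ℝ} (hA : ∀ b, |A b| ≤ Asup)
    (hsmall : P.mesh 0 * |C.e| * Asup ≤ 1) (y : HiggsLattice.Site P 0) (l : List (HiggsLattice.Site P 0)) (hch : IsTChain y l)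
    {x : HiggsLattice.Site P 0} (hend : pathEnd y l = x)
    (hM : ∀ w ∈ y :: l, ∀ μ : Fin P.d, P.mesh 0 * (regTorusKernels S C A msq a k).absDG j μ w z
          + 2 * (P.mesh 0 * |C.e| * Asup) * (regTorusKernels S C A msq a k).absG j (w.shift μ) z ≤ M) :
    |entG C A msq a k j i i' x z - entG C A msq a k j i i' y z| ≤ l.length * M := by
  subst hend
  exact entG_chain_le j i i' z hA hsmall y l hch hM

/-! ## §4 (3.65)₁ entrywise for far pairs (sizes) -/

/-- ★ **(3.65)₁ ENTRYWISE FOR FAR PAIRS** (`L^jε ≤ ε|x − y|`): sizes (`|G_{ii′}| ≤ |G|`). [cite: King1986, Prop 3.7 (3.65) p.663] [cite: Balaban1983Higgs3, (2.10) p.426] -/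
theorem entG_holder_far {δ Cst : ℝ} (hδ : 0 ≤ δ) (hCst : 0 ≤ Cst) (h210 : (regTorusKernels S C A msq a k).Ineq210 δ Cst)
    {α : ℝ} (hα0 : 0 ≤ α) (j : ℕ) (i i' : Ix N) {x y : HiggsLattice.Site P 0}
    (hfar : P.mesh j ≤ P.mesh 0 * (HiggsLattice.Site.tdist x y : ℝ)) (z : HiggsLattice.Site P 0) :
    |entG C A msq a k j i i' x z - entG C A msq a k j i i' y z|
      ≤ 2 * Cst * (P.mesh 0 * (HiggsLattice.Site.tdist x y : ℝ)) ^ α * P.mesh j ^ ((2 : ℝ) - (P.d : ℝ) - α)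
          * Real.exp (-(δ * (P.mesh j)⁻¹ * (P.mesh 0 * min (HiggsLattice.Site.tdist x z : ℝ) (HiggsLattice.Site.tdist y z : ℝ)))) := by
  have hx := (abs_entG_le (S := S) (C := C) (A := A) (msq := msq) (a := a) (k := k) j i i' x z)
  have hy := (abs_entG_le (S := S) (C := C) (A := A) (msq := msq) (a := a) (k := k) j i i' y z)
  have hε : 0 < P.mesh 0 := P.mesh_pos 0
  have hs : 0 < P.mesh j := P.mesh_pos j
  set r : ℝ := P.mesh 0 * (HiggsLattice.Site.tdist x y : ℝ) with hr
  set m : ℝ := min (HiggsLattice.Site.tdist x z : ℝ) (HiggsLattice.Site.tdist y z : ℝ) with hm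
  have hbx := (h210 j x z).1
  have hby := (h210 j y z).1
  rw [scale_eq, regTorusKernels_dist] at hbx hby
  have hρ : 0 ≤ δ * (P.mesh j)⁻¹ * P.mesh 0 := by positivity
  have hex : Real.exp (-(δ * (P.mesh j)⁻¹ * (P.mesh 0 * (HiggsLattice.Site.tdist x z : ℝ)))) ≤ Real.exp (-(δ * (P.mesh j)⁻¹ * (P.mesh 0 * m))) := by
    rw [Real.exp_le_exp, neg_le_neg_iff, ← mul_assoc, ← mul_assoc]; exact mul_le_mul_of_nonneg_left (min_le_left _ _) hρ
  have hey : Real.exp (-(δ * (P.mesh j)⁻¹ * (P.mesh 0 * (HiggsLattice.Site.tdist y z : ℝ)))) ≤ Real.exp (-(δ * (P.mesh j)⁻¹ * (P.mesh 0 * m))) := by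
    rw [Real.exp_le_exp, neg_le_neg_iff, ← mul_assoc, ← mul_assoc]; exact mul_le_mul_of_nonneg_left (min_le_right _ _) hρ
  have hsize : P.mesh j ^ ((2 : ℝ) - (P.d : ℝ)) ≤ r ^ α * P.mesh j ^ ((2 : ℝ) - (P.d : ℝ) - α) := by
    have h1 : P.mesh j ^ ((2 : ℝ) - (P.d : ℝ)) = P.mesh j ^ α * P.mesh j ^ ((2 : ℝ) - (P.d : ℝ) - α) := by
      rw [← Real.rpow_add hs]; congr 1; ring
    rw [h1]
    exact mul_le_mul_of_nonneg_right (Real.rpow_le_rpow hs.le hfar hα0) (Real.rpow_nonneg hs.le _)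
  calc |entG C A msq a k j i i' x z - entG C A msq a k j i i' y z|
      ≤ |entG C A msq a k j i i' x z| + |entG C A msq a k j i i' y z| := abs_sub _ _
    _ ≤ Cst * P.mesh j ^ ((2 : ℝ) - (P.d : ℝ)) * Real.exp (-(δ * (P.mesh j)⁻¹ * (P.mesh 0 * m)))
        + Cst * P.mesh j ^ ((2 : ℝ) - (P.d : ℝ)) * Real.exp (-(δ * (P.mesh j)⁻¹ * (P.mesh 0 * m))) :=
        add_le_add ((hx.trans hbx).trans (mul_le_mul_of_nonneg_left hex (by positivity)))
          ((hy.trans hby).trans (mul_le_mul_of_nonneg_left hey (by positivity)))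
    _ = 2 * Cst * P.mesh j ^ ((2 : ℝ) - (P.d : ℝ)) * Real.exp (-(δ * (P.mesh j)⁻¹ * (P.mesh 0 * m))) := by ring
    _ ≤ 2 * Cst * (r ^ α * P.mesh j ^ ((2 : ℝ) - (P.d : ℝ) - α)) * Real.exp (-(δ * (P.mesh j)⁻¹ * (P.mesh 0 * m))) :=
        mul_le_mul_of_nonneg_right (mul_le_mul_of_nonneg_left hsize (by positivity)) (Real.exp_nonneg _)
    _ = _ := by ring

end Torus

end Summit.QuantumFields.YangMills.BalabanUVNodes.N15KingModelRung.RegularField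

end
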